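import Summits.HodgeConjecture.HodgeConjecture.Theorems.Ring2HypothesesJacobiansSeam
import Summits.HodgeConjecture.HodgeConjecture.Theorems.Ring2HypothesesDescent
import Summits.HodgeConjecture.CorCM.Stage4StrictRoadTransitivity
import Literature.AlgebraicGeometry.Motives.AlbaneseExistenceComplex
import Literature.AlgebraicGeometry.Motives.AlbaneseByMaximality
import Literature.AlgebraicGeometry.Motives.AbelianVarietyQuotientOfJacobianHolds
import HarnessLib

/-!
# Ring 2 — hypotheses layer, descent axis: `HC_AV` IS THE HODGE CONJECTURE FOR THE CARTESIAN POWERS OF CURVES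
# (Arapura 2006 Lemma 1.3, first half, in the kernel: the Albanese variety — in particular the Jacobian of a curve,
# and every complex abelian variety — is DOMINATED by the powers of a smooth projective curve)

HONEST FRAMING (page 1, verbatim the cell's standing line): **research route conditional on HC_CM; not a
corollary; Q11.4-sentence-2 already refuted in dim ≥ 3.** Nothing in this file proves a case of the Hodge conjecture;
nothing discharges the binder of record b06 `Ring2.Hypotheses.AbsoluteHodgeImpliesAlgebraicAV` ("absolute Hodge classes
on complex abelian varieties are algebraic", `Ring2HypothesesDescent.lean` :73; OPEN, `≡ HC_AV` modulo Deligne's Main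
Theorem 2.11 = fact c1); the binder table's numbers do not move. `HC_CM` (`Theses.RankFourFaces.CMAbelianHodge`) does not
occur in this file; `HC_AV` (`Theses.PadicSemiregularLift.HodgeAbelianVarieties`) occurs only inside `↔`.

Hodge ladder STAGE 3, `BINDER-OWNERS.md` row **b06**, seat `ring2-b06` (gen 75). Gens 73–74 and the seam
`Ring2HypothesesJacobiansSeam.lean` (ring2-b01 gen 35) read `HC_AV` — and row b06 granted c1 — on finite products of
simple abelian varieties, on subquotients, and on JACOBIANS OF CURVES (`hc_av_iff_jacobians`, hypothesis-free). The one
form listed as NOT obtained there was the form on SELF-PRODUCTS OF CURVES `Cᴺ` («needs Jacobi inversion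
`C^g ↠ J(C)`»). This file obtains it WITHOUT Jacobi inversion, by the printed argument of

  D. Arapura, *Motivation for Hodge cycles*, Adv. Math. 207 (2006) 762–781, §1 Lemma 1.3 (held arXiv text
  math/0501348, Lemma 3), verbatim: «If `X` is smooth projective variety, its Albanese `Alb(X)` is motivated by `X`. If
  `X` is a smooth projective curve, `X` and its Jacobian `J(X)` are co-motivated. Proof. Let `α : X → Alb(X)` be the
  Abel–Jacobi map. Since `Alb(X)` is generated as a semigroup by the image of `α`, the map `Xⁿ → Alb(X)` given by
  `(x₁, …, xₙ) ↦ α(x₁) + … + α(xₙ)` is surjective for some `n`. This proves the first statement.»; Introduction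
  (p. 762): «For Abelian varieties, we first observe that the Jacobian of a curve is motivated by the curve.»

The SECOND statement of Lemma 1.3 (a curve is dominated by the powers of its Jacobian) is the tree's
`CorCM.Stage4.isDominatedByPowers_curve_jacobian` (`CorCM/Stage4StrictRoadCurves`, literature seat hodge-director-lit-stage4);
the FIRST statement was not in the tree. Its two inputs are PROVED theorems of the tree: (i) Serre's generation theorem
— the Albanese map `f^P : X → J` of the tree's `Motives.Jacobian X` (Milne JV Prop. 6.4, the Albanese universal property)
GENERATES `J`, i.e. some signed sum map `s_m : (X × X)^{m+1} → J`, `((xᵢ, yᵢ))ᵢ ↦ Σᵢ f^P(xᵢ) − f^P(yᵢ)`, is a SURJECTIVE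
morphism (`Jacobian.generates_abelJacobi`, `Generates.surjective_pmSum_of_dim_le`, `Motives/AlbaneseExistenceComplex`,
`Motives/AlbaneseByMaximality`: Serre, *Morphismes universels et variété d'Albanese*, Sém. Chevalley 1958/59 exp. 10,
no. 2) — this replaces «generated as a semigroup» + Jacobi inversion; (ii) Arapura's Cor. 1.2 on the tree's real carriers
— domination by the powers of a variety DESCENDS along surjective morphisms of smooth projective complex varieties of ANY
dimensions (`CorCM.Stage4.isDominatedByPowers_of_surjective`, `CorCM/Stage4StrictRoadSurjections`: `f_*` is onto by
Voisin I Lemma 7.28 transposed, and is an algebraic correspondence), applied to the source `(X × X)^{m+1}`, which is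
dominated by the powers of `X` (`isDominatedByPowers_tensor`, `isDominatedByPowers_self`).  Content (theorems only; no
definition, no named fact, no sorry):

* §1 `isSmoothProjective_pmPow`, `isDominatedByPowers_pmPow` — Serre's sources `(X × X)^{m+1}` (`Motives.pmPow X m`) are
  smooth projective of dimension `(m+1)·2 dim X` and dominated by the powers of `X`.
* §2 **`isDominatedByPowers_of_generates`** — an abelian variety GENERATED (Serre) by a morphism from a smooth
  projective complex variety `X` is dominated by the powers of `X`; **`isDominatedByPowers_albanese`** — ARAPURA 2006
  LEMMA 1.3, FIRST STATEMENT: the Albanese variety `𝒥.J` of every Albanese datum `𝒥 : Motives.Jacobian X` of a smooth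
  projective complex `X` is dominated by the powers of `X`; `isDominatedByPowers_jacobian_curve` — the Jacobian of a smooth
  projective complex curve is dominated by the powers of the curve (so, with the tree's second statement, `C` and `J(C)`
  are CO-dominated: `isDominatedByPowers_curve_jacobian_and_jacobian_curve`).
* §3 **`exists_curve_isDominatedByPowers_abelianVariety`** — EVERY COMPLEX ABELIAN VARIETY IS DOMINATED BY THE POWERS OF
  A SMOOTH PROJECTIVE CURVE (Arapura, Introduction; here: `A` is a quotient `J(C) ↠ A` of a Jacobian — Lange–Birkenhake
  Prop. 4.5.8 / Milne JV Thm. 10.1, the tree's THEOREM `langeBirkenhake1992_exists_jacobian_surjective_hom_holds`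
  (ring2-b01 gen 35) — and Cor. 1.2 again); `isDominatedByPowers_curve_of_isDominatedByPowers_abelianVariety` — hence
  Arapura's whole «strict abelian motivic type» class of `CorCM/Stage4*` (varieties dominated by the powers of an abelian
  variety: finite products of curves and abelian varieties, their smooth images and powers) consists of varieties
  dominated by the powers of ONE CURVE (`isDominatedByPowers_trans`), and conversely (`…_iff_…`).
* §4 HYPOTHESIS-FREE: **`hc_av_iff_curvePowers` — `HC_AV ⟺` THE HODGE CONJECTURE HOLDS FOR EVERY CARTESIAN POWER
  `C^{m+1}` OF EVERY SMOOTH PROJECTIVE COMPLEX CURVE `C`** (`⟹` = the tree's `CorCM.Stage4.hc_curve_powers_of_hc_av`,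
  Arapura Lemma 1.3 second half + Lemma 4.2; `⟸` = §3 + the tree's PROVED Arapura Lemma 4.2
  `hodgeConjectureFor_of_isDominatedByPowers`); all-powers form `hc_av_iff_curvePow` (`Cᵐ`, `m ≥ 0`); `¬`-form
  `not_hc_av_iff_exists_curvePower` (a counterexample to `HC_AV`, if any, can be taken on a power of a curve); PER CURVE:
  `forall_hodgeConjectureFor_jacobianPow_iff_curvePow` (HC for all powers of `J(C)` ⟺ HC for all powers of `C`); PER
  ABELIAN VARIETY: `exists_curve_hodgeConjectureFor_abelian_of_curvePowers` (for each `A` ONE curve whose powers decide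
  `A` and all `A^{m+1}`).
* §5 mod c1 only (Deligne's Main Theorem 2.11 as the displayed hypothesis `hD`, NOT asserted): **ROW b06 ⟺ the Hodge
  conjecture for the cartesian powers of smooth projective complex curves**
  (`absoluteHodgeImpliesAlgebraicAV_iff_curvePowers_of_deligne`), `¬`-form.

WHY IT IS WORTH A LINE. The powers `Cᴺ` of curves are the most concrete smooth projective varieties there are, with
`H•(Cᴺ) = H•(C)^{⊗N}` (Künneth) and Hodge classes governed by the representation theory of `Sp(H¹(C))` and of the
endomorphisms of `J(C)`; the forms below say that `HC_AV` — equivalently row b06 granted c1 — is EXACTLY the Hodge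
conjecture for these varieties (dimension `N ≥ 4` being the open content, `hc_av_iff_forall_four_le`), by name and
hypothesis-free, composable with every degree-axis form of gens 68–72, the product-of-simples forms of gen 73, the
subquotient / Jacobian forms of gen 74 and the seam. On the absolute road WITHOUT c1 the curve-power form is NOT
obtained here: the signed sum maps `(C × C)^{m+1} ↠ J(C)` are not equidimensional, and the tree descends «absolute Hodge
⟹ algebraic» only along equidimensional surjections (`Ring2HypothesesDescentAbsoluteIsogeny` §1) — an equidimensional
`C^g ↠ J(C)` (Jacobi inversion for the tree's `Motives.Jacobian`, available in the tree only for Weil's model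
`Motives.WeilJacobian.Jac`, `WeilJacobianSymmetrize.surjective_sigma`) or an absolute-Hodge version of Arapura's Lemma 4.2
(semisimplicity of André/Deligne–Milne motives) would be needed; neither is attempted.

HONEST COLUMN. Nothing is discharged; row b06 and `HC_AV` stay OPEN and are NOT asserted (`HC_AV` only inside `↔`);
c1 (`deligne1982_hodgeClasses_abelianVariety_absoluteHodge`) occurs only as the hypothesis `hD` of §5; every other input
is a THEOREM of the tree (Serre generation, Voisin I Lemma 7.28 / Gysin surjectivity, Arapura Lemma 4.2 and Cor. 1.2 on
the real carriers, Lange–Birkenhake 4.5.8 `_holds`, `2 dim J = b₁`-free); no definition, no named fact, no sorry.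
NOT obtained: the absolute-road curve-power form without c1 (above); a bound on the genus or on the number of factors
needed for a given `A` (the proof uses `(C × C)^{dim J(C)+1}` with `C` a linear curve section of `A`, genus unbounded);
a products-of-DISTINCT-curves refinement is weaker, not stronger, and is implied.

PRESEARCH: «Jacobian / Albanese / abelian varieties motivated (dominated) by powers of a curve; HC for abelian varieties
⟺ HC for powers of curves» → [corpus: paper:arxiv-math_0501348 p. 3 Lemma 3 = Arapura 2006 §1 Lemma 1.3, and p. 1
Introduction] statement and proof («generated as a semigroup … `Xⁿ → Alb(X)` surjective for some `n`»; «the Jacobian of a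
curve is motivated by the curve»); Arapura §4 Lemma 4.2 gives the HC transfer in print; corpus hybrid / vsearch («Hodge
conjecture abelian varieties equivalent powers of curves») → van Geemen (LNM 1594), Kerr–Pearlstein 2016 pp. 292–294
(Abdulali's DIFFERENT notion of domination for the GENERAL Hodge conjecture), no statement of the equivalence; galaxy
(all stars) `Hodge conjecture for products of curves|…self-products of curves|dominated by products of curves` → Schoen's
DPC condition (Schreieder), no Hodge-conjecture equivalence. No printed sentence «HC for abelian varieties ⟺ HC for powers
of curves» found — certification by assembly of Arapura 1.3 + 4.2 with Lange–Birkenhake 4.5.8; no novelty in print claimed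
beyond the kernel assembly.

References (bib keys): Arapura2006 (§1 Lemma 1.1, Cor. 1.2, Lemma 1.3; §4 Lemma 4.2; Introduction p. 762),
Serre1958MorphismesUniversels (no. 1 Déf. 1, no. 2 Thm. 1–2), Lang1983AbelianVarieties (II §3 p. 35),
Milne1986JacobianVarieties (§6 Prop. 6.1, 6.4; §10 Thm. 10.1), LangeBirkenhake1992 (Prop. 4.5.8), VoisinHodgeI2002
(§7.3.2 Lemma 7.28, Remark 7.29), CharlesSchnell2014Notes (Conj. 11.2.18), Deligne1982HodgeCycles (Main Thm. 2.11). -/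

noncomputable section

set_option linter.dupNamespace false

open CategoryTheory CategoryTheory.Limits AlgebraicGeometry MonoidalCategory CartesianMonoidalCategory
open Literature.AlgebraicGeometry Literature.AlgebraicGeometry.Motives
open Literature.AlgebraicGeometry.Motives.AbelianVariety
open Literature.AlgebraicGeometry.HodgeTheory
open Summit.HodgeConjecture.CorCM.Stage4


namespace Summit.HodgeConjecture.HodgeConjecture.Ring2.Hypotheses

open Summit.HodgeConjecture.HodgeConjecture.Theses.PadicSemiregularLift (HodgeAbelianVarieties)

/-! ## §1 Serre's sources `(X × X)^{m+1}` are smooth projective and dominated by the powers of `X` -/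

section Sources

variable {d : ℕ} {X : SchemeOver ℂ}

/-- **The sources `(X × X)^{m+1}` of Serre's sum maps are smooth projective of dimension `(m + 1) · 2 dim X`**
(Segre: `IsSmoothProjective.tensor_holds`, iterated along the tree's bracketing `Motives.pmPow X (m+1) = pmPow X m ⊗ (X ⊗ X)`).
[cite: Serre1958MorphismesUniversels, no. 1] [cite: Hartshorne1977, II Ex. 5.11 and III Prop. 10.1] -/
theorem isSmoothProjective_pmPow (hX : IsSmoothProjective d X) :
    ∀ m : ℕ, IsSmoothProjective ((m + 1) * (d + d)) (pmPow X m)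
  | 0 => by
    rw [Nat.zero_add, Nat.one_mul]
    exact hX.tensor_holds hX
  | m + 1 => by
    rw [Nat.succ_mul]
    exact (isSmoothProjective_pmPow hX m).tensor_holds (hX.tensor_holds hX)

/-- **`(X × X)^{m+1}` is dominated by the powers of `X`** (Arapura 2006 §1: the category generated from `X` is a tensor
category; on the real carriers: `X` is dominated by its own powers, `isDominatedByPowers_self`, and products of dominated
varieties are dominated, `isDominatedByPowers_tensor`). [cite: Arapura2006, §1 Lemma 1.1 and §4 Lemma 4.2] -/
theorem isDominatedByPowers_pmPow (hX : IsSmoothProjective d X) :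
    ∀ m : ℕ, IsDominatedByPowers ((m + 1) * (d + d)) (pmPow X m) d X
  | 0 => by
    rw [Nat.zero_add, Nat.one_mul]
    exact isDominatedByPowers_tensor hX hX hX (isDominatedByPowers_self hX) (isDominatedByPowers_self hX)
  | m + 1 => by
    rw [Nat.succ_mul]
    exact isDominatedByPowers_tensor hX (isSmoothProjective_pmPow hX m) (hX.tensor_holds hX)
      (isDominatedByPowers_pmPow hX m)
      (isDominatedByPowers_tensor hX hX hX (isDominatedByPowers_self hX) (isDominatedByPowers_self hX))

end Sources

/-! ## §2 Arapura 2006 Lemma 1.3, first statement: a generated abelian variety — in particular the Albanese variety,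
in particular the Jacobian of a curve — is dominated by the powers of the generating variety -/

section Albanese

variable {d : ℕ} {X C : SchemeOver ℂ}

/-- **An abelian variety GENERATED by a morphism `φ : X → A` from a smooth projective complex variety is dominated by the
powers of `X`** (Arapura 2006 Lemma 1.3, proof: «Since `Alb(X)` is generated … by the image of `α`, the map `Xⁿ → Alb(X)`
… is surjective for some `n`», and Cor. 1.2: «`Y` is motivated by `X` if there exists a surjective morphism of varieties
`f : Xⁿ → Y`»).  In the tree: `φ` generates `A` in Serre's sense (`Motives.Generates`: some signed sum map
`s_n : (X × X)^{n+1} → A` is onto), hence `s_{dim A}` is a surjective morphism (`Generates.surjective_pmSum_of_dim_le`, `X`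
being proper and geometrically integral with a complex point); its source is smooth projective and dominated by the powers
of `X` (§1); domination descends along surjective morphisms of ANY dimensions (`CorCM.Stage4.isDominatedByPowers_of_surjective`:
`(s_n)_*` is onto and an algebraic correspondence). [cite: Arapura2006, §1 Cor. 1.2 and Lemma 1.3 (proof)]
[cite: Serre1958MorphismesUniversels, no. 1 Déf. 1 and no. 2] [cite: VoisinHodgeI2002, §7.3.2 Lemma 7.28 and Remark 7.29] -/
theorem isDominatedByPowers_of_generates (hX : IsSmoothProjective d X) {A : AbelianVariety ℂ} {φ : X ⟶ A.X}
    (hφ : Generates φ) : IsDominatedByPowers A.dim A.X d X := by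
  haveI : IsProper X.hom := IsSmoothProjective.isProper_holds hX
  haveI : GeometricallyIntegral X.hom := IsSmoothProjective.geometricallyIntegral_holds hX
  obtain ⟨P⟩ := hX.nonempty_algPoints ℂ
  haveI : Surjective (pmSum φ A.dim).left := hφ.surjective_pmSum_of_dim_le P.toUnitHom le_rfl
  exact isDominatedByPowers_of_surjective hX (isSmoothProjective_pmPow hX A.dim)
    AbelianVariety.isSmoothProjective_holds (pmSum φ A.dim) (isDominatedByPowers_pmPow hX A.dim)

/-- **ARAPURA 2006, LEMMA 1.3, FIRST STATEMENT — the Albanese variety of a smooth projective complex variety `X` is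
dominated by the powers of `X`**: for every Albanese datum `𝒥 : Motives.Jacobian X` (the universal property of Milne JV
Prop. 6.4 / Lange Prop. 4.5.5, which for a curve is the Jacobian and in general the Albanese variety, Milne Remark 6.5)
every `Hᵏ(J(ℂ); ℂ)` is spanned by the images of algebraic correspondences from the cartesian powers `Xᵉ`.  The Albanese
map `f^P` of a complex point `P` GENERATES `J` (Serre no. 2 / Milne proof of Prop. 6.1, the tree's
`Jacobian.generates_abelJacobi`), and `isDominatedByPowers_of_generates` applies. [cite: Arapura2006, §1 Lemma 1.3]
[cite: Milne1986JacobianVarieties, §6 Prop. 6.1 (proof) and Remark 6.5] [cite: Serre1958MorphismesUniversels, no. 2 Thm. 1] -/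
theorem isDominatedByPowers_albanese (hX : IsSmoothProjective d X) (𝒥 : Jacobian X) :
    IsDominatedByPowers 𝒥.J.dim 𝒥.J.X d X := by
  haveI : IsProper X.hom := IsSmoothProjective.isProper_holds hX
  haveI : GeometricallyIntegral X.hom := IsSmoothProjective.geometricallyIntegral_holds hX
  obtain ⟨P⟩ := hX.nonempty_algPoints ℂ
  exact isDominatedByPowers_of_generates hX (Jacobian.generates_abelJacobi 𝒥 P)

/-- **The Jacobian of a smooth projective complex curve is dominated by the powers of the curve** («the Jacobian of a
curve is motivated by the curve», Arapura 2006, Introduction and Lemma 1.3) — for every Jacobian `𝒥` of `C` in the sense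
of the universal property of `Motives/Jacobian`.  No Jacobi inversion is used: the signed sum maps `(C × C)^{m+1} ↠ J(C)`
of Serre's generation theorem replace `C^g ↠ J(C)`. [cite: Arapura2006, §1 Lemma 1.3 and Introduction (p. 762)] -/
theorem isDominatedByPowers_jacobian_curve (hC : IsSmoothProjective 1 C) (𝒥 : Jacobian C) :
    IsDominatedByPowers 𝒥.J.dim 𝒥.J.X 1 C :=
  isDominatedByPowers_albanese hC 𝒥

/-- **Arapura 2006 Lemma 1.3 in full: a smooth projective complex curve and its Jacobian are CO-dominated** — the curve
by the powers of the Jacobian (the tree's `CorCM.Stage4.isDominatedByPowers_curve_jacobian`, `α^*` onto) and the Jacobian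
by the powers of the curve (`isDominatedByPowers_jacobian_curve`). [cite: Arapura2006, §1 Lemma 1.3] -/
theorem isDominatedByPowers_curve_jacobian_and_jacobian_curve (hC : IsSmoothProjective 1 C) (𝒥 : Jacobian C) :
    IsDominatedByPowers 1 C 𝒥.J.dim 𝒥.J.X ∧ IsDominatedByPowers 𝒥.J.dim 𝒥.J.X 1 C :=
  ⟨isDominatedByPowers_curve_jacobian hC 𝒥, isDominatedByPowers_jacobian_curve hC 𝒥⟩

end Albanese

/-! ## §3 Every complex abelian variety is dominated by the powers of a smooth projective curve -/

section AbelianVarieties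

variable {dY : ℕ} {Y : SchemeOver ℂ}

/-- **EVERY COMPLEX ABELIAN VARIETY IS DOMINATED BY THE POWERS OF A SMOOTH PROJECTIVE COMPLEX CURVE** (Arapura 2006,
Introduction: «For Abelian varieties, we first observe that the Jacobian of a curve is motivated by the curve»): `A` is
a quotient `J(C) ↠ A` of the Jacobian of a smooth projective curve (Lange–Birkenhake Prop. 4.5.8 / Milne JV Thm. 10.1 —
the tree's THEOREM `langeBirkenhake1992_exists_jacobian_surjective_hom_holds`), `J(C)` is dominated by the powers of `C`
(§2), and domination descends along the surjection (Arapura Cor. 1.2, `CorCM.Stage4.isDominatedByPowers_of_surjective`).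
Hypothesis-free. [cite: Arapura2006, Introduction (p. 762), §1 Cor. 1.2 and Lemma 1.3] [cite: LangeBirkenhake1992, Prop. 4.5.8]
[cite: Milne1986JacobianVarieties, §10 Thm. 10.1 (p. 198)] -/
theorem exists_curve_isDominatedByPowers_abelianVariety (A : AbelianVariety ℂ) :
    ∃ C : SchemeOver ℂ, IsSmoothProjective 1 C ∧ IsDominatedByPowers A.dim A.X 1 C := by
  obtain ⟨C, hC, 𝒥, φ, hφ⟩ := langeBirkenhake1992_exists_jacobian_surjective_hom_holds A
  haveI : Surjective φ.hom.hom.hom.left := hφ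
  exact ⟨C, hC, isDominatedByPowers_of_surjective hC (AbelianVariety.isSmoothProjective_holds (A := 𝒥.J))
    AbelianVariety.isSmoothProjective_holds φ.hom.hom.hom (isDominatedByPowers_jacobian_curve hC 𝒥)⟩

/-- **A variety dominated by the powers of a complex abelian variety is dominated by the powers of a smooth projective
curve** (transitivity of domination, `CorCM.Stage4.isDominatedByPowers_trans`, through §3's curve for `A`): Arapura's
«strict abelian motivic type» class of `CorCM/Stage4*` — finite products of curves and abelian varieties, their powers and
smooth images — consists of varieties dominated by the powers of ONE curve. [cite: Arapura2006, Introduction (p. 762), §1 Lemma 1.1 and Lemma 1.3] -/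
theorem isDominatedByPowers_curve_of_isDominatedByPowers_abelianVariety (hY : IsSmoothProjective dY Y)
    (A : AbelianVariety ℂ) (hYA : IsDominatedByPowers dY Y A.dim A.X) :
    ∃ C : SchemeOver ℂ, IsSmoothProjective 1 C ∧ IsDominatedByPowers dY Y 1 C := by
  obtain ⟨C, hC, hAC⟩ := exists_curve_isDominatedByPowers_abelianVariety A
  exact ⟨C, hC, isDominatedByPowers_trans hC AbelianVariety.isSmoothProjective_holds hY hYA hAC⟩

/-- **«Dominated by the powers of some abelian variety» ⟺ «dominated by the powers of some smooth projective curve»**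
(`⟸`: a curve is dominated by the powers of its Jacobian, the tree's `CorCM.Stage4.isDominatedByPowers_curve_jacobian`,
and transitivity; a Jacobian exists, `nonempty_jacobian_of_isSmoothProjective_complex`). [cite: Arapura2006, §1 Lemma 1.1 and Lemma 1.3] -/
theorem exists_isDominatedByPowers_abelianVariety_iff_curve (hY : IsSmoothProjective dY Y) :
    (∃ A : AbelianVariety ℂ, IsDominatedByPowers dY Y A.dim A.X) ↔
      ∃ C : SchemeOver ℂ, IsSmoothProjective 1 C ∧ IsDominatedByPowers dY Y 1 C := by
  refine ⟨fun ⟨A, hA⟩ ↦ isDominatedByPowers_curve_of_isDominatedByPowers_abelianVariety hY A hA, fun ⟨C, hC, hYC⟩ ↦ ?_⟩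
  obtain ⟨𝒥⟩ := nonempty_jacobian_of_isSmoothProjective_complex C hC
  exact ⟨𝒥.J, isDominatedByPowers_trans AbelianVariety.isSmoothProjective_holds hC hY hYC
    (isDominatedByPowers_curve_jacobian hC 𝒥)⟩

end AbelianVarieties

/-! ## §4 `HC_AV` is the Hodge conjecture for the cartesian powers of smooth projective curves — hypothesis-free -/

section Hodge

variable {dY : ℕ} {Y C : SchemeOver ℂ}

/-- **PER CURVE: the Hodge conjecture for all powers `C^{m+1}` of a smooth projective complex curve gives the Hodge
conjecture for its Jacobian and for all powers `J(C)^{m+1}`** (Arapura Lemma 4.2, the tree's PROVED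
`Arapura2006_hodgeClasses_algebraic_of_isDominatedByPowers_holds`, fed by §2).  The hypothesis is NOT asserted.
[cite: Arapura2006, §1 Lemma 1.3 and §4 Lemma 4.2] -/
theorem hodgeConjectureFor_jacobian_of_curvePowers (hC : IsSmoothProjective 1 C) (𝒥 : Jacobian C)
    (h : ∀ m : ℕ, HodgeConjectureFor ((m + 1) * 1) (C.pow (m + 1))) :
    HodgeConjectureFor 𝒥.J.dim 𝒥.J.X ∧ ∀ m : ℕ, HodgeConjectureFor ((m + 1) * 𝒥.J.dim) (𝒥.J.X.pow (m + 1)) :=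
  Arapura2006_hodgeClasses_algebraic_of_isDominatedByPowers_holds hC AbelianVariety.isSmoothProjective_holds
    (isDominatedByPowers_jacobian_curve hC 𝒥) h

/-- **PER CURVE, BOTH WAYS: the Hodge conjecture holds for all powers of `J(C)` iff it holds for all powers of `C`**
(co-domination, Arapura Lemma 1.3 in full, with Lemma 4.2 in each direction).  Neither side is asserted; for `C` general
of genus `g` both sides are open from dimension `4` on. [cite: Arapura2006, §1 Lemma 1.3 and §4 Lemma 4.2] -/
theorem forall_hodgeConjectureFor_jacobianPow_iff_curvePow (hC : IsSmoothProjective 1 C) (𝒥 : Jacobian C) :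
    (∀ m : ℕ, HodgeConjectureFor ((m + 1) * 𝒥.J.dim) (𝒥.J.X.pow (m + 1))) ↔
      ∀ m : ℕ, HodgeConjectureFor ((m + 1) * 1) (C.pow (m + 1)) :=
  ⟨fun h ↦ (Arapura2006_hodgeClasses_algebraic_of_isDominatedByPowers_holds AbelianVariety.isSmoothProjective_holds hC
      (isDominatedByPowers_curve_jacobian hC 𝒥) h).2,
    fun h ↦ (hodgeConjectureFor_jacobian_of_curvePowers hC 𝒥 h).2⟩

/-- **PER ABELIAN VARIETY: for every complex abelian variety `A` there is ONE smooth projective curve `C` such that the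
Hodge conjecture for the powers `C^{m+1}` implies the Hodge conjecture for `A` and for all powers `A^{m+1}`** (§3 and
Arapura Lemma 4.2).  Nothing is asserted about either side. [cite: Arapura2006, Introduction (p. 762) and §4 Lemma 4.2]
[cite: LangeBirkenhake1992, Prop. 4.5.8] -/
theorem exists_curve_hodgeConjectureFor_abelian_of_curvePowers (A : AbelianVariety ℂ) :
    ∃ C : SchemeOver ℂ, IsSmoothProjective 1 C ∧
      ((∀ m : ℕ, HodgeConjectureFor ((m + 1) * 1) (C.pow (m + 1))) →
        HodgeConjectureFor A.dim A.X ∧ ∀ m : ℕ, HodgeConjectureFor ((m + 1) * A.dim) (A.X.pow (m + 1))) := by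
  obtain ⟨C, hC, hAC⟩ := exists_curve_isDominatedByPowers_abelianVariety A
  exact ⟨C, hC, fun h ↦
    Arapura2006_hodgeClasses_algebraic_of_isDominatedByPowers_holds hC AbelianVariety.isSmoothProjective_holds hAC h⟩

/-- A smooth projective variety dominated by the powers of an abelian variety (Arapura's strict class) satisfies the Hodge
conjecture, with all its powers, as soon as the powers of ONE suitable curve do. Nothing is asserted.
[cite: Arapura2006, §1 Lemma 1.1, Lemma 1.3 and §4 Lemma 4.2] -/
theorem exists_curve_hodgeConjectureFor_of_isDominatedByPowers_abelianVariety (hY : IsSmoothProjective dY Y)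
    (A : AbelianVariety ℂ) (hYA : IsDominatedByPowers dY Y A.dim A.X) :
    ∃ C : SchemeOver ℂ, IsSmoothProjective 1 C ∧
      ((∀ m : ℕ, HodgeConjectureFor ((m + 1) * 1) (C.pow (m + 1))) →
        HodgeConjectureFor dY Y ∧ ∀ m : ℕ, HodgeConjectureFor ((m + 1) * dY) (Y.pow (m + 1))) := by
  obtain ⟨C, hC, hYC⟩ := isDominatedByPowers_curve_of_isDominatedByPowers_abelianVariety hY A hYA
  exact ⟨C, hC, fun h ↦ Arapura2006_hodgeClasses_algebraic_of_isDominatedByPowers_holds hC hY hYC h⟩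

/-- **`HC_AV ⟺ THE HODGE CONJECTURE HOLDS FOR EVERY CARTESIAN POWER `C^{m+1}` OF EVERY SMOOTH PROJECTIVE COMPLEX
CURVE `C`** — hypothesis-free.  `⟹`: a curve is dominated by the powers of its Jacobian, so `HC_AV` gives the Hodge
conjecture for `C` and all `C^{m+1}` (the tree's `CorCM.Stage4.hc_curve_powers_of_hc_av`, Arapura Lemma 1.3 + 4.2).
`⟸`: every complex abelian variety is dominated by the powers of a curve (§3) and Arapura's Lemma 4.2
(`hodgeConjectureFor_of_isDominatedByPowers`, PROVED in the tree). Neither side is asserted; the open content on the right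
is dimension `m + 1 ≥ 4`. [cite: Arapura2006, Introduction (p. 762), §1 Lemma 1.3 and §4 Lemma 4.2]
[cite: LangeBirkenhake1992, Prop. 4.5.8] [cite: Milne1986JacobianVarieties, §10 Thm. 10.1 (p. 198)] -/
theorem hc_av_iff_curvePowers :
    HodgeAbelianVarieties ↔
      ∀ (C : SchemeOver ℂ), IsSmoothProjective 1 C → ∀ m : ℕ, HodgeConjectureFor ((m + 1) * 1) (C.pow (m + 1)) := by
  refine ⟨fun hAV C hC ↦ (hc_curve_powers_of_hc_av hAV hC).2, fun h A ↦ ?_⟩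
  obtain ⟨C, hC, hAC⟩ := exists_curve_isDominatedByPowers_abelianVariety A
  exact hodgeConjectureFor_of_isDominatedByPowers hC AbelianVariety.isSmoothProjective_holds hAC (h C hC)

/-- The same with ALL cartesian powers `Cᵐ`, `m ≥ 0` (`C⁰ = Spec ℂ`, `C¹ = Spec ℂ × C`; dimension `m`), in the spelling of
the tree's `CorCM.Stage4.hc_curve_pow_of_hc_av`. Hypothesis-free; neither side asserted.
[cite: Arapura2006, §1 Lemma 1.3 and §4 Lemma 4.2] -/
theorem hc_av_iff_curvePow :
    HodgeAbelianVarieties ↔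
      ∀ (C : SchemeOver ℂ), IsSmoothProjective 1 C → ∀ m : ℕ, HodgeConjectureFor m (C.pow m) := by
  refine ⟨fun hAV C hC m ↦ hc_curve_pow_of_hc_av hAV hC m, fun h ↦ hc_av_iff_curvePowers.2 fun C hC m ↦ ?_⟩
  simpa using h C hC (m + 1)

/-- **A counterexample to `HC_AV`, if any, can be taken on a cartesian power of a smooth projective curve** (the
`¬`-form; nothing is asserted about `HC_AV`). [cite: Arapura2006, §1 Lemma 1.3 and §4 Lemma 4.2] -/
theorem not_hc_av_iff_exists_curvePower :
    ¬ HodgeAbelianVarieties ↔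
      ∃ C : SchemeOver ℂ, IsSmoothProjective 1 C ∧ ∃ m : ℕ, ¬ HodgeConjectureFor ((m + 1) * 1) (C.pow (m + 1)) := by
  rw [hc_av_iff_curvePowers]
  push Not
  exact Iff.rfl

/-- **`HC_AV ⟺` the Hodge conjecture for the Jacobians of curves AND all their powers** (the seam's `hc_av_iff_jacobians`
strengthened on the right by the powers, through the per-curve equivalence). Hypothesis-free; neither side asserted.
[cite: Arapura2006, §1 Lemma 1.3 and §4 Lemma 4.2] [cite: LangeBirkenhake1992, Prop. 4.5.8] -/
theorem hc_av_iff_jacobianPowers :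
    HodgeAbelianVarieties ↔
      ∀ (C : SchemeOver ℂ), IsSmoothProjective 1 C → ∀ (𝒥 : Jacobian C) (m : ℕ),
        HodgeConjectureFor ((m + 1) * 𝒥.J.dim) (𝒥.J.X.pow (m + 1)) := by
  rw [hc_av_iff_curvePowers]
  refine ⟨fun h C hC 𝒥 ↦ (forall_hodgeConjectureFor_jacobianPow_iff_curvePow hC 𝒥).2 (h C hC), fun h C hC ↦ ?_⟩
  obtain ⟨𝒥⟩ := nonempty_jacobian_of_isSmoothProjective_complex C hC
  exact (forall_hodgeConjectureFor_jacobianPow_iff_curvePow hC 𝒥).1 (h C hC 𝒥)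

end Hodge

/-! ## §5 Row b06 is the Hodge conjecture for the cartesian powers of curves — modulo c1 only -/

section Absolute

/-- **ROW b06 ⟺ THE HODGE CONJECTURE FOR THE CARTESIAN POWERS `C^{m+1}` OF SMOOTH PROJECTIVE COMPLEX CURVES, modulo
c1 only** (Deligne's Main Theorem 2.11 «Hodge classes on abelian varieties are absolute Hodge» as the displayed hypothesis
`hD`, NOT asserted: row b06 `⟺ HC_AV`, `hc_av_iff_absoluteHodgeImpliesAlgebraicAV_of_deligne`, and §4).  Row b06 is NOT
asserted; no (N), no (E). [cite: Deligne1982HodgeCycles, Main Thm. 2.11 (p. 19)] [cite: CharlesSchnell2014Notes, §11.2 Conj. 11.2.18]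
[cite: Arapura2006, §1 Lemma 1.3 and §4 Lemma 4.2] -/
theorem absoluteHodgeImpliesAlgebraicAV_iff_curvePowers_of_deligne
    (hD : deligne1982_hodgeClasses_abelianVariety_absoluteHodge) :
    AbsoluteHodgeImpliesAlgebraicAV ↔
      ∀ (C : SchemeOver ℂ), IsSmoothProjective 1 C → ∀ m : ℕ, HodgeConjectureFor ((m + 1) * 1) (C.pow (m + 1)) :=
  (hc_av_iff_absoluteHodgeImpliesAlgebraicAV_of_deligne hD).symm.trans hc_av_iff_curvePowers

/-- All-powers spelling of the same (mod c1 only; row b06 NOT asserted). [cite: Deligne1982HodgeCycles, Main Thm. 2.11 (p. 19)]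
[cite: Arapura2006, §1 Lemma 1.3 and §4 Lemma 4.2] -/
theorem absoluteHodgeImpliesAlgebraicAV_iff_curvePow_of_deligne
    (hD : deligne1982_hodgeClasses_abelianVariety_absoluteHodge) :
    AbsoluteHodgeImpliesAlgebraicAV ↔
      ∀ (C : SchemeOver ℂ), IsSmoothProjective 1 C → ∀ m : ℕ, HodgeConjectureFor m (C.pow m) :=
  (hc_av_iff_absoluteHodgeImpliesAlgebraicAV_of_deligne hD).symm.trans hc_av_iff_curvePow

/-- **A counterexample to row b06, if any, yields — granted c1 — a power of a smooth projective curve violating the Hodge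
conjecture**, and conversely (`¬`-form; nothing asserted). [cite: Deligne1982HodgeCycles, Main Thm. 2.11 (p. 19)]
[cite: Arapura2006, §1 Lemma 1.3 and §4 Lemma 4.2] -/
theorem not_absoluteHodgeImpliesAlgebraicAV_iff_exists_curvePower_of_deligne
    (hD : deligne1982_hodgeClasses_abelianVariety_absoluteHodge) :
    ¬ AbsoluteHodgeImpliesAlgebraicAV ↔
      ∃ C : SchemeOver ℂ, IsSmoothProjective 1 C ∧ ∃ m : ℕ, ¬ HodgeConjectureFor ((m + 1) * 1) (C.pow (m + 1)) := by
  rw [absoluteHodgeImpliesAlgebraicAV_iff_curvePowers_of_deligne hD]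
  push Not
  exact Iff.rfl

end Absolute

end Summit.HodgeConjecture.HodgeConjecture.Ring2.Hypotheses

end
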